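import Summits.NavierStokesRegularity.NavierStokesRegularity.Theorems.ScenarioCensusTemporalSpectrumOscillatory
import Summits.NavierStokesRegularity.NavierStokesRegularity.Theorems.ScenarioCensusModeRankShell
import HarnessLib

/-!
# LINE «temporal-spectrum» port, part 4/12: §H `row_A1cx_pos`, `row_A1cx_holds`, nesting `row_A1cx_of_row_A1qp`, bookkeeping

Re-homed for the scenario census (typer seat ns-census-typer-1 g8; the cells A1ex / A1po are MEMBERS OF RECORD «DECIDED IN KERNEL IN FILES» of row A1apT since census
v1.69 and A1jb / A1cs / A1qx / A1cx since v1.71 (critic idea-crit-3 g6 PASS — no price 20:33:05Z, RE-STAMPs REV 2 → REV 3 → REV 4 22:13:50Z; ref ns-census-ref g8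
PRE-CHECK ✓ §13.14 item 11 + items 19/20; lit §21.21 / §21.24 (a)); this port makes them TREE-decided): VERBATIM PORT of ns-idea-2 LINE g12-2 «temporal-spectrum»
REV 4, `pub/ideators/ns-idea-2/lines/temporal-spectrum/line-temporal-spectrum.lean` sha16 f2331f3a0765e1d4 (3431 l., lean check rc 0, 0 sorry), split for the
400-line rule into twelve parts `ScenarioCensusTemporalSpectrum{∅, Exponential, Oscillatory, OscillatoryRow, Jordan, Complex, ComplexDecay, ComplexRow, Quasi, QuasiGroup,
QuasiRow, Head}` (chain imports).  Lean text VERBATIM in namespace `…Theorems.ScenarioCensus.TemporalSpectrum` (the line's `…Lines.TemporalSpectrum` re-homed);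
port edits: the two `local notation "E3"` lines → one `abbrev E3` at namespace level and the bracket lines `section Rows` / `end Rows` dropped (no `variable`s
there; typer lint: no notation in port files), `@[conjecture]` on the OPEN head `Row_A1qp` (typed only), twenty-one one-line docstrings added (gate lint); the
lemmas the line shares VERBATIM with «mode-rank» / «floquet-meter» (§B spatial Liouville lemmas, the instrument `vortB` / `vortB_sum_sum`, the gauge
`tendsto_slice_atBot` / `eq_zero_of_curl_slice_const`, `laplacian_zero_apply`, `norm_curl_le_four_mul`) are taken BY NAME from those landed ports (listed
below); `tendsto_typeI_bound` (twin of a landed tree lemma in a module the farm does not build) is not re-declared and its four uses carry the one-line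
Mathlib proof inline (proof text only).  Statements untouched.

No census VALUE is moved here (row A1apT keeps its value; the members become TREE-decided by name); NS regularity is NOT proved; (L′) ⟨10661⟩ is
untouched; no summit statement is proved by this file. Lemmas that restate already-landed tree declarations are taken BY NAME (gate lint `dedup.landed`): `apply_eq_apply_of_harmonic_bounded` = `ModeRank.apply_eq_apply_of_harmonic_bounded`, `apply_eq_apply_of_curl_const` = `ModeRank.apply_eq_apply_of_curl_const`, `nonpos_of_laplacian_eq_mul` = `ModeRank.nonpos_of_laplacian_eq_mul`, `eq_zero_of_laplacian_eq_smul_of_pos` = `ModeRank.eq_zero_of_laplacian_eq_smul_of_pos`, `vortB` = `ModeRank.vortB`, `vortB_sum_sum` = `ModeRank.vortB_sum_sum`, `tendsto_slice_atBot` = `ModeRank.tendsto_slice_atBot`, `eq_zero_of_curl_slice_const` = `ModeRank.eq_zero_of_curl_slice_const`, `laplacian_zero_apply` = `ModeRank.laplacian_zero_fun`, `norm_curl_le_four_mul` = `FloquetMeter.norm_curl_le_four_mul`.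
-/

-- the summit and its single problem share the name `NavierStokesRegularity` (D-0017 nested layout)
set_option linter.dupNamespace false

noncomputable section

open Set Function Filter Topology

namespace Summit.NavierStokesRegularity.NavierStokesRegularity.Theorems.ScenarioCensus.TemporalSpectrum

open Literature.Analysis Literature.Analysis.FluidPDE InnerProductSpace
open Summit.NavierStokesRegularity.NavierStokesRegularity.Theorems (vorticity_eq_deriv_of_typeI)
open scoped Laplacian InnerProductSpace RealInnerProductSpace ContDiff

/-- The oscillatory cell for a positive frequency `b > 0`. -/
theorem row_A1cx_pos {C : ℝ} {u : ℝ → E3 → E3} (hu : IsTypeIAncientMild C u) {a b : ℝ}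
    (hb : 0 < b) {ψ χ : E3 → E3} (hψ : ContDiff ℝ 3 ψ) (hχ : ContDiff ℝ 3 χ)
    (hbψ : ∃ A : ℝ, ∀ x, ‖curl ψ x‖ ≤ A) (hbχ : ∃ A : ℝ, ∀ x, ‖curl χ x‖ ≤ A)
    (hsl : ∀ t < 0, ∀ x, u t x =
      Real.exp (a * t) • (Real.cos (b * t) • ψ x + Real.sin (b * t) • χ x)) :
    ∀ t < 0, ∀ x, u t x = 0 := by
  classical
  -- the mode pair as a `Fin 2` family
  let φ : Fin 2 → E3 → E3 := ![ψ, χ]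
  let c : ℝ → Fin 2 → ℝ := fun s => ![Real.exp (a * s) * Real.cos (b * s),
    Real.exp (a * s) * Real.sin (b * s)]
  have hφ : ∀ k, ContDiff ℝ 3 (φ k) := fun k => by
    fin_cases k <;> simp [φ, hψ, hχ]
  have hcφ : ∀ k, ContDiff ℝ 2 (curl (φ k)) := fun k => contDiff_curl (hφ k)
  have hdφ : ∀ k, Differentiable ℝ (φ k) := fun k => (hφ k).differentiable (by norm_num)
  have hsl' : ∀ s < 0, ∀ y, u s y = ∑ k, c s k • φ k y := by
    intro s hs y
    rw [hsl s hs y, Fin.sum_univ_two]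
    simp only [φ, c, Matrix.cons_val_zero, Matrix.cons_val_one, smul_add, smul_smul]
  have hslF : ∀ s < 0, u s = fun y => ∑ k, c s k • φ k y := fun s hs => funext (hsl' s hs)
  have hcurl : ∀ s < 0, curl (u s) = fun y => ∑ k, c s k • curl (φ k) y := by
    intro s hs; funext y; rw [hslF s hs]; exact curl_sum_smul hdφ _ y
  -- ### Case `a ≤ 0`: Type-I decay along the trigonometric lattice kills `ψ` and `χ`
  by_cases ha : a ≤ 0
  · have hsmall : ∀ x, ∀ ε > 0, ∃ T, ∀ s ≤ T, s < 0 → ‖u s x‖ < ε := by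
      intro x ε hε
      have h := (ModeRank.tendsto_slice_atBot hu x)
      rw [tendsto_zero_iff_norm_tendsto_zero] at h
      have h2 := (h.eventually (gt_mem_nhds hε))
      rw [eventually_atBot] at h2
      obtain ⟨T, hT⟩ := h2
      exact ⟨T, fun s hs _ => hT s hs⟩
    have hexp : ∀ s < 0, 1 ≤ Real.exp (a * s) := fun s hs =>
      Real.one_le_exp (mul_nonneg_of_nonpos_of_nonpos ha hs.le)
    have hψ0 : ∀ x, ψ x = 0 := by
      intro x
      by_contra hne
      have hε : 0 < ‖ψ x‖ := norm_pos_iff.2 hne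
      obtain ⟨T, hT⟩ := hsmall x ‖ψ x‖ hε
      obtain ⟨s, hsT, hs0, hc1, hs1⟩ := exists_le_cos_eq_one hb T
      have h1 := hT s hsT hs0
      rw [hsl s hs0 x, hc1, hs1, one_smul, zero_smul, add_zero, norm_smul,
        Real.norm_of_nonneg (Real.exp_pos _).le] at h1
      nlinarith [hexp s hs0, norm_nonneg (ψ x)]
    have hχ0 : ∀ x, χ x = 0 := by
      intro x
      by_contra hne
      have hε : 0 < ‖χ x‖ := norm_pos_iff.2 hne
      obtain ⟨T, hT⟩ := hsmall x ‖χ x‖ hε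
      obtain ⟨s, hsT, hs0, hc0, hs1⟩ := exists_le_sin_eq_neg_one hb T
      have h1 := hT s hsT hs0
      rw [hsl s hs0 x, hc0, hs1, zero_smul, zero_add, neg_one_smul, smul_neg, norm_neg, norm_smul,
        Real.norm_of_nonneg (Real.exp_pos _).le] at h1
      nlinarith [hexp s hs0, norm_nonneg (χ x)]
    intro t ht x
    rw [hsl t ht x, hψ0 x, hχ0 x]
    simp
  -- ### Case `a > 0`
  push Not at ha
  -- derivatives of the coefficients
  have hdc : ∀ t, ∀ k, HasDerivAt (fun s => c s k)
      ((![Real.exp (a * t) * a * Real.cos (b * t) - Real.exp (a * t) * Real.sin (b * t) * b,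
          Real.exp (a * t) * a * Real.sin (b * t) + Real.exp (a * t) * Real.cos (b * t) * b]
        : Fin 2 → ℝ) k) t := by
    intro t k
    have he : HasDerivAt (fun s => Real.exp (a * s)) (Real.exp (a * t) * a) t := by
      have h1 : HasDerivAt (fun s => a * s) a t := by
        simpa using (hasDerivAt_id t).const_mul a
      simpa using h1.exp
    have hb1 : HasDerivAt (fun s => b * s) b t := by
      simpa using (hasDerivAt_id t).const_mul b
    have hcos : HasDerivAt (fun s => Real.cos (b * s)) (-Real.sin (b * t) * b) t := hb1.cos
    have hsin : HasDerivAt (fun s => Real.sin (b * s)) (Real.cos (b * t) * b) t := hb1.sin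
    fin_cases k
    · simp only [c, Fin.zero_eta, Fin.isValue, Matrix.cons_val_zero]
      exact (he.fun_mul hcos).congr_deriv (by ring)
    · simp only [c, Fin.mk_one, Fin.isValue, Matrix.cons_val_one, Matrix.cons_val_fin_one]
      exact (he.fun_mul hsin).congr_deriv (by ring)
  -- the vorticity identity along the mode pair, in separated form `E•V + (E*E)•W = 0`
  have hE : ∀ t < 0, ∀ x,
      Real.exp (a * t) •
          (Real.cos (b * t) • (a • curl ψ x + b • curl χ x - (Δ (curl ψ)) x)
            + Real.sin (b * t) • (a • curl χ x - b • curl ψ x - (Δ (curl χ)) x))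
        + (Real.exp (a * t) * Real.exp (a * t)) •
          ((Real.cos (b * t) * Real.cos (b * t)) • ModeRank.vortB ψ (curl ψ) x
            + (Real.cos (b * t) * Real.sin (b * t)) • (ModeRank.vortB ψ (curl χ) x + ModeRank.vortB χ (curl ψ) x)
            + (Real.sin (b * t) * Real.sin (b * t)) • ModeRank.vortB χ (curl χ) x) = 0 := by
    intro t ht x
    have h2 := vorticity_eq_deriv_of_typeI hu ht x
    have hd : deriv (fun s => curl (u s) x) t
        = ∑ k, ((![Real.exp (a * t) * a * Real.cos (b * t) - Real.exp (a * t) * Real.sin (b * t) * b,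
            Real.exp (a * t) * a * Real.sin (b * t) + Real.exp (a * t) * Real.cos (b * t) * b]
            : Fin 2 → ℝ) k) • curl (φ k) x := by
      have hev : (fun s => curl (u s) x) =ᶠ[𝓝 t] fun s => ∑ k, c s k • curl (φ k) x := by
        filter_upwards [Iio_mem_nhds ht] with s hs
        rw [hcurl s hs]
      rw [hev.deriv_eq]
      exact (hasDerivAt_sum_smul (fun k => curl (φ k) x) (hdc t)).deriv
    have hB : fderiv ℝ (curl (u t)) x (u t x) - fderiv ℝ (u t) x (curl (u t) x)
        = ∑ i, ∑ j, (c t i * c t j) • ModeRank.vortB (φ i) (curl (φ j)) x := by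
      have := ModeRank.vortB_sum_sum φ (fun j => curl (φ j)) (c t) (c t) (x := x) (fun l => hdφ l x)
        (fun j => (hcφ j).differentiable (by norm_num) x)
      rw [hcurl t ht, hslF t ht]
      simpa only [ModeRank.vortB] using this
    have hL : (Δ (curl (u t))) x = ∑ k, c t k • (Δ (curl (φ k))) x := by
      rw [hcurl t ht]; exact laplacian_sum_smul hcφ _ x
    have h3 : deriv (fun s => curl (u s) x) t
        + (fderiv ℝ (curl (u t)) x (u t x) - fderiv ℝ (u t) x (curl (u t) x))
        - (Δ (curl (u t))) x = 0 := by rw [← sub_eq_zero.2 h2]; abel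
    rw [hd, hB, hL] at h3
    simp only [Fin.sum_univ_two, φ, c, Matrix.cons_val_zero, Matrix.cons_val_one] at h3
    rw [← h3]
    module
  -- periodicity separates the trigonometric part from the exponential weights
  have hVW : ∀ t < 0, ∀ x,
      Real.cos (b * t) • (a • curl ψ x + b • curl χ x - (Δ (curl ψ)) x)
        + Real.sin (b * t) • (a • curl χ x - b • curl ψ x - (Δ (curl χ)) x) = 0 := by
    intro t ht x
    set V := Real.cos (b * t) • (a • curl ψ x + b • curl χ x - (Δ (curl ψ)) x)
        + Real.sin (b * t) • (a • curl χ x - b • curl ψ x - (Δ (curl χ)) x) with hV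
    set W := (Real.cos (b * t) * Real.cos (b * t)) • ModeRank.vortB ψ (curl ψ) x
        + (Real.cos (b * t) * Real.sin (b * t)) • (ModeRank.vortB ψ (curl χ) x + ModeRank.vortB χ (curl ψ) x)
        + (Real.sin (b * t) * Real.sin (b * t)) • ModeRank.vortB χ (curl χ) x with hW
    set t' := t - 2 * Real.pi / b with ht'def
    have hπ := Real.pi_pos
    have ht' : t' < 0 := by
      have : 0 < 2 * Real.pi / b := by positivity
      linarith
    have hcos' : Real.cos (b * t') = Real.cos (b * t) := by
      have : b * t' = b * t - 2 * Real.pi := by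
        rw [ht'def, mul_sub, mul_div_cancel₀ _ hb.ne']
      rw [this, Real.cos_sub_two_pi]
    have hsin' : Real.sin (b * t') = Real.sin (b * t) := by
      have : b * t' = b * t - 2 * Real.pi := by
        rw [ht'def, mul_sub, mul_div_cancel₀ _ hb.ne']
      rw [this, Real.sin_sub_two_pi]
    have e1 : Real.exp (a * t) • V + (Real.exp (a * t) * Real.exp (a * t)) • W = 0 := hE t ht x
    have e2 : Real.exp (a * t') • V + (Real.exp (a * t') * Real.exp (a * t')) • W = 0 := by
      have := hE t' ht' x
      rw [hcos', hsin'] at this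
      exact this
    have hE1 : Real.exp (a * t) ≠ 0 := (Real.exp_pos _).ne'
    have hE2 : Real.exp (a * t') ≠ 0 := (Real.exp_pos _).ne'
    have f1 : V + Real.exp (a * t) • W = 0 := by
      have : Real.exp (a * t) • (V + Real.exp (a * t) • W) = 0 := by
        rw [smul_add, smul_smul]; exact e1
      exact (smul_eq_zero.1 this).resolve_left hE1
    have f2 : V + Real.exp (a * t') • W = 0 := by
      have : Real.exp (a * t') • (V + Real.exp (a * t') • W) = 0 := by
        rw [smul_add, smul_smul]; exact e2
      exact (smul_eq_zero.1 this).resolve_left hE2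
    have hne : Real.exp (a * t) - Real.exp (a * t') ≠ 0 := by
      intro h
      have h' := Real.exp_eq_exp.1 (sub_eq_zero.1 h)
      have : t = t' := mul_left_cancel₀ ha.ne' h'
      have : (0 : ℝ) < 2 * Real.pi / b := by positivity
      linarith
    have hW0 : W = 0 := by
      have : (Real.exp (a * t) - Real.exp (a * t')) • W
          = (V + Real.exp (a * t) • W) - (V + Real.exp (a * t') • W) := by
        rw [sub_smul]; abel
      rw [f1, f2, sub_zero] at this
      exact (smul_eq_zero.1 this).resolve_left hne
    rw [hW0, smul_zero, add_zero] at f1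
    exact f1
  -- the rotating shell system for the two vorticities
  have hX : ∀ x, (Δ (curl ψ)) x = a • curl ψ x + b • curl χ x := by
    intro x
    have hπ := Real.pi_pos
    have ht1 : -(2 * Real.pi) / b < 0 := by
      rw [div_lt_iff₀ hb]; nlinarith
    have h := hVW _ ht1 x
    rw [mul_div_cancel₀ _ hb.ne', Real.cos_neg, Real.sin_neg, Real.cos_two_pi, Real.sin_two_pi,
      neg_zero, one_smul, zero_smul, add_zero] at h
    exact (sub_eq_zero.1 h).symm
  have hY : ∀ x, (Δ (curl χ)) x = a • curl χ x - b • curl ψ x := by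
    intro x
    have hπ := Real.pi_pos
    have ht2 : -(Real.pi / 2) / b < 0 := by
      rw [div_lt_iff₀ hb]; nlinarith
    have h := hVW _ ht2 x
    rw [mul_div_cancel₀ _ hb.ne', Real.cos_neg, Real.sin_neg, Real.cos_pi_div_two,
      Real.sin_pi_div_two, zero_smul, zero_add, neg_one_smul, neg_eq_zero] at h
    exact (sub_eq_zero.1 h).symm
  obtain ⟨A, hA⟩ := hbψ
  obtain ⟨B, hB⟩ := hbχ
  obtain ⟨hp0, hq0⟩ := eq_zero_of_laplacian_pair (hcφ 0) (hcφ 1) ha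
    (fun x => by simpa [φ] using hX x) (fun x => by simpa [φ] using hY x)
    (fun x => by simpa [φ] using hA x) (fun x => by simpa [φ] using hB x)
  have hψ0 : curl ψ = 0 := by simpa [φ] using hp0
  have hχ0 : curl χ = 0 := by simpa [φ] using hq0
  -- ### gauge
  refine ModeRank.eq_zero_of_curl_slice_const hu fun t ht => ⟨0, fun x => ?_⟩
  rw [hcurl t ht]
  simp [Fin.sum_univ_two, φ, hψ0, hχ0]

/-- **Row A1cx decided** (any non-zero frequency; `b < 0` is reduced to `b > 0` by
`(b, χ) ↦ (-b, -χ)`). -/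
theorem row_A1cx_holds : Row_A1cx := by
  intro C u hu a b ψ χ hb hψ hχ hbψ hbχ hsl
  rcases lt_or_gt_of_ne hb with hneg | hpos
  · have hχ' : ContDiff ℝ 3 (fun x => -χ x) := hχ.neg
    have hbχ' : ∃ A : ℝ, ∀ x, ‖curl (fun x => -χ x) x‖ ≤ A := by
      obtain ⟨A, hA⟩ := hbχ
      refine ⟨A, fun x => ?_⟩
      have h1 : (fun x => -χ x) = fun x => (-1 : ℝ) • χ x := by funext y; simp
      rw [h1, curl_const_smul ((hχ.differentiable (by norm_num)) x) (-1 : ℝ), neg_one_smul,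
        norm_neg]
      exact hA x
    refine row_A1cx_pos (a := a) hu (neg_pos.2 hneg) hψ hχ' hbψ hbχ' fun t ht x => ?_
    rw [hsl t ht x]
    simp [neg_mul, Real.cos_neg, Real.sin_neg, smul_neg, neg_smul]
  · exact row_A1cx_pos hu hpos hψ hχ hbψ hbχ hsl

/-! ### Nesting: the open head contains the oscillatory cell (`L = (∂ₜ - a)² + b²`) -/

/-- The oscillatory mode family `s ↦ e^{as}((α cos bs + β sin bs) P + (α sin bs - β cos bs) Q)`,
closed under `d/ds`. -/
def oscF (a b α β : ℝ) (P Q : E3) : ℝ → E3 := fun s =>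
  Real.exp (a * s) • ((α * Real.cos (b * s) + β * Real.sin (b * s)) • P
    + (α * Real.sin (b * s) - β * Real.cos (b * s)) • Q)

/-- The derivative of the oscillatory profile `oscF`. -/
theorem hasDerivAt_oscF (a b α β : ℝ) (P Q : E3) (s : ℝ) :
    HasDerivAt (oscF a b α β P Q) (oscF a b (a * α + b * β) (a * β - b * α) P Q s) s := by
  have he : HasDerivAt (fun s => Real.exp (a * s)) (Real.exp (a * s) * a) s := by
    have h1 : HasDerivAt (fun s => a * s) a s := by
      simpa using (hasDerivAt_id s).const_mul a
    simpa using h1.exp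
  have hb1 : HasDerivAt (fun s => b * s) b s := by
    simpa using (hasDerivAt_id s).const_mul b
  have hcos : HasDerivAt (fun s => Real.cos (b * s)) (-Real.sin (b * s) * b) s := hb1.cos
  have hsin : HasDerivAt (fun s => Real.sin (b * s)) (Real.cos (b * s) * b) s := hb1.sin
  have hA : HasDerivAt (fun s => α * Real.cos (b * s) + β * Real.sin (b * s))
      (α * (-Real.sin (b * s) * b) + β * (Real.cos (b * s) * b)) s :=
    (hcos.const_mul α).add (hsin.const_mul β)
  have hB : HasDerivAt (fun s => α * Real.sin (b * s) - β * Real.cos (b * s))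
      (α * (Real.cos (b * s) * b) - β * (-Real.sin (b * s) * b)) s :=
    (hsin.const_mul α).sub (hcos.const_mul β)
  have hV : HasDerivAt (fun s => (α * Real.cos (b * s) + β * Real.sin (b * s)) • P
      + (α * Real.sin (b * s) - β * Real.cos (b * s)) • Q)
      ((α * (-Real.sin (b * s) * b) + β * (Real.cos (b * s) * b)) • P
        + (α * (Real.cos (b * s) * b) - β * (-Real.sin (b * s) * b)) • Q) s :=
    (hA.smul_const P).add (hB.smul_const Q)
  have h := he.smul hV
  refine h.congr_deriv ?_
  simp only [oscF]
  module

/-- `deriv` form of `hasDerivAt_oscF`. -/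
theorem deriv_oscF (a b α β : ℝ) (P Q : E3) :
    deriv (oscF a b α β P Q) = oscF a b (a * α + b * β) (a * β - b * α) P Q :=
  funext fun s => (hasDerivAt_oscF a b α β P Q s).deriv

/-- **Nesting.** The open head `Row_A1qp` implies the oscillatory cell `Row_A1cx`: the signal
`e^{at}(cos(bt)ψ + sin(bt)χ)` is annihilated by `L = ∂ₜ² - 2a∂ₜ + (a² + b²)`. -/
theorem row_A1cx_of_row_A1qp (h : Row_A1qp) : Row_A1cx := by
  classical
  intro C u hu a b ψ χ _hb _hψ _hχ _hbψ _hbχ hsl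
  refine h C u hu 2 ![a ^ 2 + b ^ 2, -2 * a] fun x t ht => ?_
  have hev : (fun s => u s x) =ᶠ[𝓝 t] oscF a b 1 0 (ψ x) (χ x) := by
    filter_upwards [Iio_mem_nhds ht] with s hs
    rw [hsl s hs x]
    simp [oscF]
  have hD : ∀ m : ℕ, iteratedDeriv m (fun s => u s x) t
      = iteratedDeriv m (oscF a b 1 0 (ψ x) (χ x)) t := fun m => hev.iteratedDeriv_eq m
  have h2 : ∀ F : ℝ → E3, iteratedDeriv 2 F = deriv (deriv F) := fun F => by
    show iteratedDeriv (0 + 1 + 1) F = deriv (deriv F)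
    rw [iteratedDeriv_succ, iteratedDeriv_succ, iteratedDeriv_zero]
  simp only [Fin.sum_univ_two, Fin.isValue, Matrix.cons_val_zero, Matrix.cons_val_one,
    Fin.val_zero, Fin.val_one, hD, h2, iteratedDeriv_zero, iteratedDeriv_one, deriv_oscF]
  simp only [oscF]
  module

/-- Bookkeeping (REV 2): the three decided temporal-spectrum cells of this line. -/
theorem temporalSpectrum_cells_decided₂ : Row_A1ex ∧ Row_A1po ∧ Row_A1cx :=
  ⟨row_A1ex_holds, row_A1po_holds, row_A1cx_holds⟩

/-- Bookkeeping (REV 2): the open head contains all three decided cells. -/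
theorem cells_of_row_A1qp (h : Row_A1qp) : Row_A1ex ∧ Row_A1po ∧ Row_A1cx :=
  ⟨row_A1ex_of_row_A1qp h, row_A1po_of_row_A1qp h, row_A1cx_of_row_A1qp h⟩

end Summit.NavierStokesRegularity.NavierStokesRegularity.Theorems.ScenarioCensus.TemporalSpectrum

end
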